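import Literature.AlgebraicGeometry.Frobenioids.ModelFrobenioidUnits
import Literature.AnabelianGeometry.EtaleTheta.BiKummerRoots

/-!
# [EtTh] Theorem 4.4 (iv): reduction to Proposition 4.3 (ii); bi-Kummer sections lie over `H_{B_N}`

S. Mochizuki, *The étale theta function and its Frobenioid-theoretic manifestations*, Publ. RIMS **45**
(2009) [MochizukiEtTh2009], §4, Theorem 4.4 (iv) p.94 (PDF; printed p.320), proof p.95: "(iv) … up to
the [simultaneous and non-simultaneous] conjugation operations discussed in Proposition 4.3, (ii), the
isomorphisms `H_{B₁} ≅ H_{B₂}`; `Aut_{C₁}(B₁) ≅ Aut_{C₂}(B₂)` map `s'₁{}^{gp} ↦ s'₂{}^{gp}`,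
`s''₁{}^{gp} ↦ s''₂{}^{gp}`".  Proof-side companion of the statement file `BiKummerRoots.lean` (v4), written
by its owner (abc-iut-L2-t3, gen 2).  Kernel-checked here:

* `BiKummerRoot.autBase_sNum` / `autBase_sDen` — the bi-Kummer sections `s'{}^{gp}, s''{}^{gp}` LIE OVER
  `H_{B_N}`: `Base(s'{}^{gp}(k)) = Base(k)` (print: "`s'_N{}^{gp} : H_{B_N} → Aut_C(B_N)`" with
  `H_{B_N} ⊆ Aut_C(B_N)/O^×(B_N)`, p.90) — from `comm_num`, the section property `autBase_striv` of
  `s_N^triv` and the pin `autBase_ident` (v4) of the identification `H_{A_N} ≅ H_{B_N}`.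
* `BiKummerRoot.transport` — a bi-Kummer root of `R₁` in `C₁` is TRANSPORTED along `Ψ` and an
  identification of the root diagrams (`Ψ(A_{1,N}) ≅ A_{2,N}`, `Ψ(B_{1,N}) ≅ B_{2,N}` intertwining the
  numerator pre-steps, the denominators up to `u₀ ∈ μ_N(B_{2,N})`) to a bi-Kummer root of `R₂` in `C₂`:
  `s^triv`, `ident`, `s'` are conjugated, `s''` in addition by `u₀`; the section property and the pin are
  transported through `Base ∘ Ψ ≅ Ψ^bs ∘ Base` (`Thm44Hyp.comm`).
* `BiKummerRoot.autBase_comm_of_conj_reparam` — the twist obstruction in kernel form (see History):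
  a unit conjugating `s' ∘ ident` into `s' ∘ ident ∘ conj g⁻¹` forces `Base(g)` central in `Base(H_{A_N})`.
* `BiKummerSetting.thm44_iv_of_prop43_ii` — **Thm 4.4 (iv), as typed (v4), follows from Prop 4.3 (ii)
  for `C₂`** applied to the transported root and `K₂` (the printed proof's route, p.95: (iv) is formal
  from the uniqueness of bi-Kummer roots up to the conjugations (a), (b)); the `μ_N`-part absorbs `u₀`
  because `O^×(B_{2,N})` is commutative ([FrdI] Rmk 1.3.1; `ModelFrobenioid.isMulCommutative_units`).

History (R-9, why v3/v4): with `BiKummerRoot.ident` free (v1/v2) the twist of a bi-Kummer root by an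
inner automorphism `conj g` of `H_{A_N}` was again a bi-Kummer root, and v2's `Thm44_iv` at `Ψ = id`
then forced `Base(H_{A_N}) ⊆ Aut_D(A_N^bs)` to be commutative (kernel derivation from the verbatim v2 text:
cell staging `HOME/staging/L2/L2-t3/Thm44Scratch.lean`); v4 pins `ident` over the base and binds the
identification of the root diagrams in `Thm44_iv`, after which (iv) is the theorem below.

HONEST FRAMING: refereed pre-IUT material ([EtTh] 2009); nothing here bears on [IUTchIII] Cor. 3.12;
typed ≠ discharged — `thm44_iv_of_prop43_ii` discharges (iv) MODULO the named `Prop` `Prop43_ii`.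
-/

noncomputable section

namespace Literature.AnabelianGeometry.EtaleTheta

open CategoryTheory Opposite Literature.AlgebraicGeometry.Frobenioids

namespace BiKummerSetting

universe u₀ v₀ u v w

variable {K : Type u₀} [Field K]
variable {X : SemiGraphs.TemperedArithmeticGroup.{u₀} K} {D₀ : Type u₀} [Category.{v₀} D₀] {V : FrdIMonoidStub.{w}}
  {T : RealifiedDivisorMonoids (D₀ := D₀) V} {D : Type u} [Category.{v} D]
  {VD : FrdICatStub.{u, v, w} D} (S : BiKummerSetting X T D VD)

/-! ### Small API over the §4 setting: `Base` of units, of pre-steps; `O^×` commutative; `μ_N` a group -/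

/-- `(Base σ).hom = Base(σ.hom)` for an automorphism `σ`. [cite: MochizukiEtTh2009, Def 4.1 p.87] -/
theorem autBase_hom {A : S.C} (σ : Aut A) : (S.autBase A σ).hom = S.base.map σ.hom := rfl

/-- Units are base-identity automorphisms: `Base(ζ) = 1` for `ζ ∈ O^×(A)` ([FrdI] Def 1.2 (ii)).
[cite: MochizukiEtTh2009, Def 4.1 p.87] -/
theorem autBase_eq_one_of_mem_units {A : S.C} {ζ : Aut A} (hζ : ζ ∈ S.units A) :
    S.autBase A ζ = 1 :=
  Aut.ext hζ.1

/-- A pre-step is a base-isomorphism ([FrdI] Def 1.2 (iii)). [cite: MochizukiEtTh2009, Def 4.1 p.86] -/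
theorem isIso_base_map_of_isPreStep {A B : S.C} {s : A ⟶ B} (hs : S.IsPreStep s) :
    IsIso (S.base.map s) := hs.2

/-- `O^×(A)` is commutative ([FrdI] Rmk 1.3.1; for the model category of the tempered Frobenioid this
is `ModelFrobenioid.isMulCommutative_units`). [cite: MochizukiEtTh2009, Prop 4.3 p.91] -/
theorem units_comm {A : S.C} {x y : Aut A} (hx : x ∈ S.units A) (hy : y ∈ S.units A) :
    x * y = y * x := by
  have hx' : x ∈ ModelFrobenioid.units A := hx
  have hy' : y ∈ ModelFrobenioid.units A := hy
  exact congrArg Subtype.val ((ModelFrobenioid.isMulCommutative_units A).is_comm.comm ⟨x, hx'⟩ ⟨y, hy'⟩)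

/-- `μ_N(A)` is closed under inverses. [cite: MochizukiEtTh2009, Def 4.1 p.87] -/
theorem inv_mem_mu {A : S.C} {N : ℕ+} {u : Aut A} (hu : u ∈ S.mu A N) : u⁻¹ ∈ S.mu A N :=
  ⟨(S.units A).inv_mem hu.1, by rw [inv_pow, hu.2, inv_one]⟩

/-- `μ_N(A)` is closed under products (its elements commute, being units).
[cite: MochizukiEtTh2009, Def 4.1 p.87] -/
theorem mul_mem_mu {A : S.C} {N : ℕ+} {u u' : Aut A} (hu : u ∈ S.mu A N) (hu' : u' ∈ S.mu A N) :
    u * u' ∈ S.mu A N :=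
  ⟨(S.units A).mul_mem hu.1 hu'.1,
    by rw [(Commute.mul_pow (S.units_comm hu.1 hu'.1)), hu.2, hu'.2, one_mul]⟩

variable {S}

/-! ### The bi-Kummer sections lie over `H_{B_N}` -/

/-- From `comm_num` and `autBase_striv`: `Base(s'_N) ≫ Base(s'{}^{gp}(ident h)) = Base(h) ≫ Base(s'_N)`.
[cite: MochizukiEtTh2009, Prop 4.3 p.90] -/
theorem BiKummerRoot.base_sNum_ident {A B : S.C} {f : S.biratUnits A} {P : S.FractionPair f B}
    {N : ℕ+} {pullFrac : ∀ {A A' : S.C} (_ : A' ⟶ A), S.biratUnits A → S.biratUnits A'}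
    {R : S.NthRoot f P N pullFrac} {hA : S.IsGalois R.AN} {hB : S.IsGalois R.BN}
    (Kr : S.BiKummerRoot R hA hB) (h : S.HA R.AN hA) :
    S.base.map R.pair.num ≫ S.base.map (Kr.sNum (Kr.ident h)).hom =
      S.base.map (h : Aut R.AN).hom ≫ S.base.map R.pair.num := by
  have hc := congrArg S.base.map (Kr.comm_num h)
  rw [Functor.map_comp, Functor.map_comp] at hc
  have hs : S.base.map (Kr.striv h).hom = S.base.map (h : Aut R.AN).hom :=
    congrArg Iso.hom (Kr.autBase_striv h)
  rw [hs] at hc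
  exact hc

/-- The same for the `s''`-section. [cite: MochizukiEtTh2009, Prop 4.3 p.90] -/
theorem BiKummerRoot.base_sDen_ident {A B : S.C} {f : S.biratUnits A} {P : S.FractionPair f B}
    {N : ℕ+} {pullFrac : ∀ {A A' : S.C} (_ : A' ⟶ A), S.biratUnits A → S.biratUnits A'}
    {R : S.NthRoot f P N pullFrac} {hA : S.IsGalois R.AN} {hB : S.IsGalois R.BN}
    (Kr : S.BiKummerRoot R hA hB) (h : S.HA R.AN hA) :
    S.base.map R.pair.den ≫ S.base.map (Kr.sDen (Kr.ident h)).hom =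
      S.base.map (h : Aut R.AN).hom ≫ S.base.map R.pair.den := by
  have hc := congrArg S.base.map (Kr.comm_den h)
  rw [Functor.map_comp, Functor.map_comp] at hc
  have hs : S.base.map (Kr.striv h).hom = S.base.map (h : Aut R.AN).hom :=
    congrArg Iso.hom (Kr.autBase_striv h)
  rw [hs] at hc
  exact hc

/-- **`s'{}^{gp}` lies over `H_{B_N}`**: `Base(s'{}^{gp}(k)) = Base(k)` for every `k ∈ H_{B_N}` — print's
"`s'_N{}^{gp} : H_{B_N} → Aut_C(B_N)`", `H_{B_N} ⊆ Aut_C(B_N)/O^×(B_N)` (p.90), i.e. `s'{}^{gp}` is a section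
over `H_{B_N}`; from `base_sNum_ident` and the pin `autBase_ident`, `Base(s'_N)` being an epimorphism
(a pre-step is a base-isomorphism). [cite: MochizukiEtTh2009, Prop 4.3 p.90] -/
theorem BiKummerRoot.autBase_sNum {A B : S.C} {f : S.biratUnits A} {P : S.FractionPair f B}
    {N : ℕ+} {pullFrac : ∀ {A A' : S.C} (_ : A' ⟶ A), S.biratUnits A → S.biratUnits A'}
    {R : S.NthRoot f P N pullFrac} {hA : S.IsGalois R.AN} {hB : S.IsGalois R.BN}
    (Kr : S.BiKummerRoot R hA hB) (k : S.HA R.BN hB) :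
    S.autBase R.BN (Kr.sNum k) = S.autBase R.BN (k : Aut R.BN) := by
  apply Aut.ext
  show S.base.map (Kr.sNum k).hom = S.base.map (k : Aut R.BN).hom
  haveI : IsIso (S.base.map R.pair.num) := S.isIso_base_map_of_isPreStep R.pair.isPreStep_num
  refine (cancel_epi (S.base.map R.pair.num)).1 ?_
  have h1 := Kr.base_sNum_ident (Kr.ident.symm k)
  have h2 := Kr.autBase_ident (Kr.ident.symm k)
  rw [MulEquiv.apply_symm_apply] at h1 h2
  exact h1.trans h2.symm

/-- **`s''{}^{gp}` lies over `H_{B_N}`**: `Base(s''{}^{gp}(k)) = Base(k)`. [cite: MochizukiEtTh2009, Prop 4.3 p.90] -/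
theorem BiKummerRoot.autBase_sDen {A B : S.C} {f : S.biratUnits A} {P : S.FractionPair f B}
    {N : ℕ+} {pullFrac : ∀ {A A' : S.C} (_ : A' ⟶ A), S.biratUnits A → S.biratUnits A'}
    {R : S.NthRoot f P N pullFrac} {hA : S.IsGalois R.AN} {hB : S.IsGalois R.BN}
    (Kr : S.BiKummerRoot R hA hB) (k : S.HA R.BN hB) :
    S.autBase R.BN (Kr.sDen k) = S.autBase R.BN (k : Aut R.BN) := by
  apply Aut.ext
  show S.base.map (Kr.sDen k).hom = S.base.map (k : Aut R.BN).hom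
  haveI : IsIso (S.base.map R.pair.den) := S.isIso_base_map_of_isPreStep R.pair.isPreStep_den
  refine (cancel_epi (S.base.map R.pair.den)).1 ?_
  have h1 := Kr.base_sDen_ident (Kr.ident.symm k)
  have h2 := Kr.autBase_ident (Kr.ident.symm k)
  rw [MulEquiv.apply_symm_apply] at h1 h2
  -- the pin is stated with `Base(s'_N)`; `s', s''` are base-equivalent
  have hbe : S.base.map R.pair.den = S.base.map R.pair.num := R.pair.base_eq.symm
  rw [hbe] at h1 ⊢
  exact h1.trans h2.symm

/-! ### Reparametrising `ident` by an inner automorphism of `H_{A_N}`: what a unit conjugation would force -/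

/-- **The twist obstruction** (kernel form of the R-9 finding that produced v3/v4 of `Thm44_iv`): if a unit
`ζ ∈ O^×(B_N)` conjugates the `s'`-section of a bi-Kummer root into its reparametrisation by the inner
automorphism `conj g⁻¹` of `H_{A_N}` — `s'(ident h) = ζ · s'(ident(g⁻¹ h g)) · ζ⁻¹` for all `h` — then
`Base(g)` commutes with every `Base(h)` in `Aut_D(A_N^bs)`.  With `BiKummerRoot.ident` free (v1/v2) the
reparametrised sections WERE a bi-Kummer root and v2's `Thm44_iv` at `Ψ = id` supplied such a `ζ` for
every `g` (so `Base(H_{A_N})` had to be commutative); the pin `autBase_ident` (v4) excludes the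
reparametrisation for non-central `Base(g)`. Uses only `comm_num`, `autBase_striv`, and that units are
base-identity. [cite: MochizukiEtTh2009, Thm 4.4 p.94] -/
theorem BiKummerRoot.autBase_comm_of_conj_reparam {A B : S.C} {f : S.biratUnits A}
    {P : S.FractionPair f B} {N : ℕ+}
    {pullFrac : ∀ {A A' : S.C} (_ : A' ⟶ A), S.biratUnits A → S.biratUnits A'}
    {R : S.NthRoot f P N pullFrac} {hA : S.IsGalois R.AN} {hB : S.IsGalois R.BN}
    (Kr : S.BiKummerRoot R hA hB) (g : S.HA R.AN hA) {ζ : Aut R.BN} (hζ : ζ ∈ S.units R.BN)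
    (hconj : ∀ h : S.HA R.AN hA,
      Kr.sNum (Kr.ident h) = ζ * Kr.sNum (Kr.ident (g⁻¹ * h * g)) * ζ⁻¹)
    (h : S.HA R.AN hA) :
    S.autBase R.AN (g : Aut R.AN) * S.autBase R.AN (h : Aut R.AN) =
      S.autBase R.AN (h : Aut R.AN) * S.autBase R.AN (g : Aut R.AN) := by
  have hζhom : S.base.map ζ.hom = 𝟙 _ := hζ.1
  have hζinv : S.base.map ζ.inv = 𝟙 _ := ((S.units R.BN).inv_mem hζ).1
  -- `Base` does not see the unit conjugation
  have e1 : S.base.map (Kr.sNum (Kr.ident h)).hom =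
      S.base.map (Kr.sNum (Kr.ident (g⁻¹ * h * g))).hom := by
    rw [hconj h]
    simp only [Aut.Aut_mul_def, Aut.Aut_inv_def, Iso.trans_hom, Iso.symm_hom, Functor.map_comp]
    rw [hζinv, hζhom, Category.id_comp, Category.comp_id]
  -- compare through `Base(s'_N)`
  have b1 := Kr.base_sNum_ident h
  have b2 := Kr.base_sNum_ident (g⁻¹ * h * g)
  rw [e1, b2] at b1
  haveI : IsIso (S.base.map R.pair.num) := S.isIso_base_map_of_isPreStep R.pair.isPreStep_num
  have hbase := (cancel_mono (S.base.map R.pair.num)).1 b1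
  -- `Base(g⁻¹ h g) = Base(h)` in `Aut_D(A_N^bs)`
  have key : S.autBase R.AN ((g : Aut R.AN)⁻¹ * (h : Aut R.AN) * (g : Aut R.AN)) =
      S.autBase R.AN (h : Aut R.AN) :=
    Aut.ext hbase
  rw [map_mul, map_mul, map_inv] at key
  conv_lhs => rw [← key]
  rw [← mul_assoc, ← mul_assoc, mul_inv_cancel, one_mul]

/-! ### Transport of a bi-Kummer root along `Ψ` and an identification of the root diagrams -/

section Transport

variable {K' : Type u₀} [Field K'] {X₁ : SemiGraphs.TemperedArithmeticGroup.{u₀} K}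
  {X₂ : SemiGraphs.TemperedArithmeticGroup.{u₀} K'} {D₀' : Type u₀} [Category.{v₀} D₀']
  {T₁ : RealifiedDivisorMonoids (D₀ := D₀) V} {T₂ : RealifiedDivisorMonoids (D₀ := D₀') V}
  {D₁ D₂ : Type u} [Category.{v} D₁] [Category.{v} D₂] {VD₁ : FrdICatStub.{u, v, w} D₁}
  {VD₂ : FrdICatStub.{u, v, w} D₂} {S₁ : BiKummerSetting X₁ T₁ D₁ VD₁} {S₂ : BiKummerSetting X₂ T₂ D₂ VD₂}

/-- `Base₂(Ψ(φ))` is `Ψ^bs(Base₁(φ))` conjugated by the comparison `Base ∘ Ψ ≅ Ψ^bs ∘ Base`.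
[cite: MochizukiEtTh2009, Thm 4.4 p.93] -/
theorem Thm44Hyp.base_map_Ψ (h : Thm44Hyp S₁ S₂) {Y Y' : S₁.C} (φ : Y ⟶ Y') :
    S₂.base.map (h.Ψ.functor.map φ) =
      h.comm.inv.app Y ≫ h.Ψbs.functor.map (S₁.base.map φ) ≫ h.comm.hom.app Y' := by
  have hn := h.comm.hom.naturality φ
  simp only [Functor.comp_map] at hn
  have e : (h.comm.app Y).inv ≫ (h.Ψbs.functor.map (S₁.base.map φ) ≫ h.comm.hom.app Y') =
      S₂.base.map (h.Ψ.functor.map φ) := by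
    rw [Iso.inv_comp_eq]
    exact hn
  exact e.symm

/-- Automorphisms with the same image in `Aut_{D₁}(Y^bs)` are transported to automorphisms with the same
image in `Aut_{D₂}(Z^bs)`. [cite: MochizukiEtTh2009, Thm 4.4 p.94] -/
theorem Thm44Hyp.autBase_transportAut_congr (h : Thm44Hyp S₁ S₂) {Y : S₁.C} {Z : S₂.C}
    (e : h.Ψ.functor.obj Y ≅ Z) {σ τ : Aut Y} (hστ : S₁.autBase Y σ = S₁.autBase Y τ) :
    S₂.autBase Z (h.transportAut e σ) = S₂.autBase Z (h.transportAut e τ) := by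
  apply Aut.ext
  have hb : S₁.base.map σ.hom = S₁.base.map τ.hom := congrArg Iso.hom hστ
  change S₂.base.map (h.transportAut e σ).hom = S₂.base.map (h.transportAut e τ).hom
  rw [h.transportAut_hom, h.transportAut_hom, Functor.map_comp, Functor.map_comp, Functor.map_comp,
    Functor.map_comp, h.base_map_Ψ, h.base_map_Ψ, hb]

/-- Composable squares of `Base₁`-images are transported by `Ψ` to squares of `Base₂`-images (through
`Base ∘ Ψ ≅ Ψ^bs ∘ Base`). [cite: MochizukiEtTh2009, Thm 4.4 p.94] -/
theorem Thm44Hyp.base_map_Ψ_square (h : Thm44Hyp S₁ S₂) {W Y Y' Z : S₁.C} {a : W ⟶ Y} {b : Y ⟶ Z}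
    {c : W ⟶ Y'} {d : Y' ⟶ Z} (hsq : S₁.base.map a ≫ S₁.base.map b = S₁.base.map c ≫ S₁.base.map d) :
    S₂.base.map (h.Ψ.functor.map a) ≫ S₂.base.map (h.Ψ.functor.map b) =
      S₂.base.map (h.Ψ.functor.map c) ≫ S₂.base.map (h.Ψ.functor.map d) := by
  rw [← Functor.map_comp, ← Functor.map_comp, ← Functor.map_comp, ← Functor.map_comp]
  have key : (S₁.base ⋙ h.Ψbs.functor).map (a ≫ b) = (S₁.base ⋙ h.Ψbs.functor).map (c ≫ d) := by
    show h.Ψbs.functor.map (S₁.base.map (a ≫ b)) = h.Ψbs.functor.map (S₁.base.map (c ≫ d))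
    rw [S₁.base.map_comp, S₁.base.map_comp, hsq]
  have n1 := h.comm.hom.naturality (a ≫ b)
  have n2 := h.comm.hom.naturality (c ≫ d)
  rw [key] at n1
  exact (cancel_epi (h.comm.hom.app W)).1 (n1.symm.trans n2)

/-- **Transport of a bi-Kummer root** of `R₁` (in `C₁`) to a bi-Kummer root of `R₂` (in `C₂`) along `Ψ`
and an identification of the root diagrams (`eAN`, `eB` intertwining the numerator pre-steps exactly and
the denominator pre-steps up to `u₀`): `s^triv`, `ident`, `s'` are conjugated, `s''` in addition by `u₀`.
It is a bi-Kummer root because `Base ∘ Ψ ≅ Ψ^bs ∘ Base`. [cite: MochizukiEtTh2009, Thm 4.4 p.94] -/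
def BiKummerRoot.transport (h : Thm44Hyp S₁ S₂)
    {pullFrac₁ : ∀ {A A' : S₁.C} (_ : A' ⟶ A), S₁.biratUnits A → S₁.biratUnits A'}
    {pullFrac₂ : ∀ {A A' : S₂.C} (_ : A' ⟶ A), S₂.biratUnits A → S₂.biratUnits A'}
    {A₁ B₁ : S₁.C} {f₁ : S₁.biratUnits A₁} {P₁ : S₁.FractionPair f₁ B₁} {N : ℕ+}
    {R₁ : S₁.NthRoot f₁ P₁ N pullFrac₁} {hA₁ : S₁.IsGalois R₁.AN} {hB₁ : S₁.IsGalois R₁.BN}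
    (K₁ : S₁.BiKummerRoot R₁ hA₁ hB₁)
    {A₂ B₂ : S₂.C} {f₂ : S₂.biratUnits A₂} {P₂ : S₂.FractionPair f₂ B₂}
    {R₂ : S₂.NthRoot f₂ P₂ N pullFrac₂} {hA₂ : S₂.IsGalois R₂.AN} {hB₂ : S₂.IsGalois R₂.BN}
    (eAN : h.Ψ.functor.obj R₁.AN ≅ R₂.AN) (eB : h.Ψ.functor.obj R₁.BN ≅ R₂.BN)
    (hnum : eAN.inv ≫ h.Ψ.functor.map R₁.pair.num ≫ eB.hom = R₂.pair.num)
    (u₀ : Aut R₂.BN)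
    (hden : eAN.inv ≫ h.Ψ.functor.map R₁.pair.den ≫ eB.hom ≫ u₀.hom = R₂.pair.den)
    (ηA : S₁.HA R₁.AN hA₁ ≃* S₂.HA R₂.AN hA₂)
    (hηA : ∀ g, ((ηA g : S₂.HA R₂.AN hA₂) : Aut R₂.AN) =
      eAN.symm ≪≫ h.Ψ.functor.mapIso (g : Aut R₁.AN) ≪≫ eAN)
    (η : S₁.HA R₁.BN hB₁ ≃* S₂.HA R₂.BN hB₂)
    (hη : ∀ k, ((η k : S₂.HA R₂.BN hB₂) : Aut R₂.BN) =
      eB.symm ≪≫ h.Ψ.functor.mapIso (k : Aut R₁.BN) ≪≫ eB) : S₂.BiKummerRoot R₂ hA₂ hB₂ where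
  striv := (h.transportAut eAN).comp (K₁.striv.comp ηA.symm.toMonoidHom)
  autBase_striv g₂ := by
    have hg : ((g₂ : S₂.HA R₂.AN hA₂) : Aut R₂.AN) =
        h.transportAut eAN ((ηA.symm g₂ : S₁.HA R₁.AN hA₁) : Aut R₁.AN) := by
      conv_lhs => rw [← ηA.apply_symm_apply g₂]
      rw [hηA]
      exact (h.transportAut_apply eAN _).symm
    rw [hg]
    exact h.autBase_transportAut_congr eAN (K₁.autBase_striv (ηA.symm g₂))
  ident := ηA.symm.trans (K₁.ident.trans η)
  autBase_ident g₂ := by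
    -- `g₂ = Ψ-transport of g := ηA⁻¹ g₂`, `ident' g₂ = Ψ-transport of ident g`
    have hg : ((g₂ : S₂.HA R₂.AN hA₂) : Aut R₂.AN) =
        h.transportAut eAN ((ηA.symm g₂ : S₁.HA R₁.AN hA₁) : Aut R₁.AN) := by
      conv_lhs => rw [← ηA.apply_symm_apply g₂]
      rw [hηA]
      exact (h.transportAut_apply eAN _).symm
    have hk : (((ηA.symm.trans (K₁.ident.trans η)) g₂ : S₂.HA R₂.BN hB₂) : Aut R₂.BN) =
        h.transportAut eB ((K₁.ident (ηA.symm g₂) : S₁.HA R₁.BN hB₁) : Aut R₁.BN) := by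
      rw [MulEquiv.trans_apply, MulEquiv.trans_apply, hη]
      exact (h.transportAut_apply eB _).symm
    rw [hk, hg, h.transportAut_hom, h.transportAut_hom, ← hnum]
    simp only [Functor.map_comp, Category.assoc, Iso.map_hom_inv_id_assoc]
    rw [reassoc_of% (h.base_map_Ψ_square (K₁.autBase_ident (ηA.symm g₂)))]
  sNum := (h.transportAut eB).comp (K₁.sNum.comp η.symm.toMonoidHom)
  sDen := (MulAut.conj u₀).toMonoidHom.comp ((h.transportAut eB).comp (K₁.sDen.comp η.symm.toMonoidHom))
  comm_num g₂ := by
    simp only [MonoidHom.coe_comp, Function.comp_apply, MulEquiv.coe_toMonoidHom,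
      MulEquiv.trans_apply, MulEquiv.symm_apply_apply, Thm44Hyp.transportAut_hom]
    rw [← hnum]
    have hc := congrArg h.Ψ.functor.map (K₁.comm_num (ηA.symm g₂))
    rw [Functor.map_comp, Functor.map_comp] at hc
    simp only [Category.assoc, Iso.hom_inv_id_assoc]
    rw [← Category.assoc (h.Ψ.functor.map R₁.pair.num), hc]
    simp only [Category.assoc]
  comm_den g₂ := by
    simp only [MonoidHom.coe_comp, Function.comp_apply, MulEquiv.coe_toMonoidHom,
      MulEquiv.trans_apply, MulEquiv.symm_apply_apply, MulAut.conj_apply, Aut.Aut_mul_def,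
      Aut.Aut_inv_def, Iso.trans_hom, Iso.symm_hom, Thm44Hyp.transportAut_hom]
    rw [← hden]
    have hc := congrArg h.Ψ.functor.map (K₁.comm_den (ηA.symm g₂))
    rw [Functor.map_comp, Functor.map_comp] at hc
    simp only [Category.assoc, Iso.hom_inv_id_assoc]
    rw [← Category.assoc (h.Ψ.functor.map R₁.pair.den), hc]
    simp only [Category.assoc]

/-! ### Theorem 4.4 (iv) from Proposition 4.3 (ii) -/

/-- **[EtTh] Theorem 4.4 (iv) ⇐ Proposition 4.3 (ii)** (printed proof, p.95: (iv) is formal from the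
uniqueness of bi-Kummer roots up to the conjugations (a), (b)): the transported root `K₁.transport …` of
`R₂` and `K₂` have the same identification and `O^×(A_{2,N})`-conjugate trivializing sections, so
`Prop43_ii` for `C₂` compares their sections; solving for the transported sections gives (iv), the
`μ_N`-part absorbing the `u₀` of the root identification (units commute).
[cite: MochizukiEtTh2009, Thm 4.4 p.94] -/
theorem thm44_iv_of_prop43_ii (h : Thm44Hyp S₁ S₂)
    (ψ : ∀ A : S₁.C, S₁.biratUnits A ≃* S₂.biratUnits (h.Ψ.functor.obj A))
    (pullFrac₁ : ∀ {A A' : S₁.C} (_ : A' ⟶ A), S₁.biratUnits A → S₁.biratUnits A')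
    (pullFrac₂ : ∀ {A A' : S₂.C} (_ : A' ⟶ A), S₂.biratUnits A → S₂.biratUnits A')
    (h43 : S₂.Prop43_ii pullFrac₂) : Thm44_iv h ψ pullFrac₁ pullFrac₂ := by
  intro A₁ B₁ f₁ P₁ N R₁ hA₁ hB₁ K₁ A₂ B₂ eA f₂ _hf P₂ R₂ hA₂ hB₂ K₂ eAN eB hnum hden ηA hηA η hη
    hident hstriv _ hA₂o
  obtain ⟨u₀, hden⟩ := hden
  -- the transported root
  let K₁' : S₂.BiKummerRoot R₂ hA₂ hB₂ :=
    K₁.transport h eAN eB hnum (u₀ : Aut R₂.BN) hden ηA hηA η hη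
  have hident' : K₂.ident = K₁'.ident := by
    apply MulEquiv.ext
    intro g₂
    have e := hident (ηA.symm g₂)
    rw [ηA.apply_symm_apply] at e
    rw [e]
    rfl
  have hstriv' : ∃ ζA : S₂.units R₂.AN, ∀ g₂,
      K₂.striv g₂ = (ζA : Aut R₂.AN) * K₁'.striv g₂ * (ζA : Aut R₂.AN)⁻¹ := by
    obtain ⟨ζA, hζA⟩ := hstriv
    refine ⟨ζA, fun g₂ => ?_⟩
    have e := hζA (ηA.symm g₂)
    rw [ηA.apply_symm_apply] at e
    rw [e]
    rfl
  obtain ⟨ζ, u, hζu⟩ := h43 R₂ hA₂ hB₂ K₁' K₂ hident' hstriv' hA₂o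
  have hζinv : ((ζ⁻¹ : S₂.units R₂.BN) : Aut R₂.BN) = (ζ : Aut R₂.BN)⁻¹ := rfl
  refine ⟨ζ⁻¹, ⟨(u₀ : Aut R₂.BN)⁻¹ * (u : Aut R₂.BN)⁻¹,
    S₂.mul_mem_mu (S₂.inv_mem_mu u₀.2) (S₂.inv_mem_mu u.2)⟩, fun hh => ?_⟩
  obtain ⟨h1, h2⟩ := hζu (η hh)
  have e1 : K₁'.sNum (η hh) = h.transportAut eB (K₁.sNum hh) := by
    change h.transportAut eB (K₁.sNum (η.symm (η hh))) = _
    rw [η.symm_apply_apply]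
  have e2 : K₁'.sDen (η hh) =
      (u₀ : Aut R₂.BN) * h.transportAut eB (K₁.sDen hh) * (u₀ : Aut R₂.BN)⁻¹ := by
    change (MulAut.conj (u₀ : Aut R₂.BN)) (h.transportAut eB (K₁.sDen (η.symm (η hh)))) = _
    rw [η.symm_apply_apply, MulAut.conj_apply]
  rw [e1] at h1
  rw [e2] at h2
  rw [← h.transportAut_apply eB, ← h.transportAut_apply eB]
  refine ⟨?_, ?_⟩
  · rw [hζinv, h1]
    group
  · have hUZ : (u : Aut R₂.BN) * (ζ : Aut R₂.BN) = (ζ : Aut R₂.BN) * (u : Aut R₂.BN) :=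
      S₂.units_comm u.2.1 ζ.2
    rw [hζinv, h2, hUZ]
    group

end Transport

end BiKummerSetting

end Literature.AnabelianGeometry.EtaleTheta
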